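import Summits.QuantumFields.YangMills.Theorems.FluctuationComparisonRegPrIntLS2BetaCornerOfRecord
import Summits.QuantumFields.YangMills.Theorems.FluctuationComparisonRegPrIntLS2BetaJacPiSinc
import Summits.QuantumFields.YangMills.Theorems.FluctuationComparisonRegPrIntLS2BetaTubularChartDockLocalWinId
import HarnessLib

/-!
# S2β · DET-REP (B) — THE TUBE OF RECORD WITH ITS COVER ROW: `exists_tubeRows_framed` re-run over px21 g17's window-identity ∕ cover twin
# (✓`…TubularChartDockLocalWinId.exists_tubularHaarChart_pivotAct_local_winId`), exporting (F6′) «every fine field whose relative comb coordinates on the free bonds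
# lie in the half-window is `pivotAct k (σ y)` with `y` IN THE TUBE-OF-RECORD WINDOW»

Cell `ym3-torus` (rung R3: continuum `SU(2)` Yang–Mills on `T³` — NOT `d = 4`, NOT infinite volume, NOT a mass gap, NOT Clay); seat
`ymfull-r3-prover-4` g0 (R590-ym (a) item (4), DET-REP (B)); definition-free helper of the crux `stmt-QuantumFields-20520`
(`--supports … --as helper`, NOT a proof of it and NOT a proof of any registered stub).  Sequel of ✓p784923 `…S2BetaTubeOfRecordFramed` (same construction, same
proof) over px21 g17's (Q-TUBE)(ii) chain ✓`…ExpChartOpenBall` → ✓`…TreeGaugeChartLocalCover` → ✓`…TubularChartActLocalWinId` → ✓`…TubularChartDockLocalWinId`.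

WHAT.  ★★ `exists_tubeRows_cover` — the conclusion of ✓`exists_tubeRows_framed` VERBATIM (tube of record through `U₀`: `σ 0 = U₀`, `0 ∈ UV`, positivity rows, window
bound, `∀ y ∈ UV, 0 < jV y`, (D0), (D1), (F4a), (F4b′), the nineteen `TubeRows` conjuncts by text) PLUS, inserted after (F4b′): **(F6′) COVER AT THE TUBE-OF-RECORD LEVEL**
`∀ V', (∀ free b, (T_{U₀}(b₋)·U₀ b·T_{U₀}(b₊)⁻¹)⁻¹·(T_{V'}(b₋)·V' b·T_{V'}(b₊)⁻¹) ∈ window (s_C∕2)) → ∃ y ∈ UV, ∃ w : residualSubgroup, ↑w = (x ↦ T_{V'}(x)⁻¹·T_{U₀}(x)) ∧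
V' = pivotAct ι (w, c ↦ V'(ι c)·U₀(ι c)⁻¹) (σ y)` — px21's docked (F6) with `y` certified to lie in the SHRUNK window `UV` of the tube of record (by (F5) `UV₀ = eV⁻¹' ball 0 (s_C∕2)`
and `s_C < log 2 < 1`: the sup-norm bound gives `‖(eV y)_b‖ < s_C∕2 < ½` on every free bond).  With ✓`…S2BetaSignedCombSupLipschitz.qTube_of_bondwiseClose_gaugeAct` (the knit,
(F6′) is its `hF6`) and ✓`…S2BetaCornerInTube.cornerRows_text_of_pivotAct_eq`, the EDGE third of `DetRepB` at a non-base corner now reads: CLOSE-BOND-MIN ⟹ corner rows.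

HONEST SCOPE.  A re-export over landed letters (zero new mathematics); def-free; default heartbeats; proves nothing of CLOSE-BOND-MIN ∕ (β) ∕ DETN ∕ JACW ∕ DET-REP (B) ∕
GAP♯ ∕ S2β ∕ the crux 20520; finite-volume∕conditional programme; `YM3TorusSU2` NOT proved; rung R3 = SU(2) YM₃ on T³ — NOT d = 4, NOT infinite volume, NOT a mass gap, NOT
Clay; the Yang–Mills mass gap is NOT proved.

References: [Helgason2000] Ch. I §1 Thm 1.14 p. 96; [Balaban1985Variational] CMP 102 (1985) Thm 1 (8)–(10) p. 279, (19) p. 281; [Balaban1985Averaging] CMP 98 (1985)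
(8), (10) p. 18; [Balaban1985RegularSpaces] CMP 99 (1985) Lemma 1 (1.25) p. 79.
-/

noncomputable section

open MeasureTheory MeasureTheory.Measure Filter Topology Set Function Metric
open scoped ENNReal Matrix.Norms.L2Operator ContDiff
open Literature.MathematicalPhysics.QuantumFieldTheory.Balaban1983to89
open Literature.MathematicalPhysics.QuantumFieldTheory.Balaban1983to89.T3ContinuumYM3Torus
open Literature.MathematicalPhysics.QuantumFieldTheory.Balaban1983to89.HaarExponentialChart
open Literature.MathematicalPhysics.QuantumFieldTheory.Balaban1983to89.LogChartProduct
open Literature.MathematicalPhysics.QuantumFieldTheory.Balaban1983to89.T3UnitLawDensityEML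
open Literature.MathematicalPhysics.QuantumFieldTheory.Balaban1983to89.T3TiltDescent
open Literature.MathematicalPhysics.QuantumFieldTheory.Balaban1983to89.T3ConstrainedMinimiser (fibre)
open Literature.MathematicalPhysics.QuantumFieldTheory.Balaban1983to89.T4Continuum
open Literature.MathematicalPhysics.QuantumFieldTheory.Balaban1983to89.B13HaarSigmaJacobian (jac)
open scoped Literature.MathematicalPhysics.QuantumFieldTheory.Balaban1983to89.T3OrbitAverage
open Summit.QuantumFields.YangMills.Theorems.FluctuationComparisonRegPrIntLWregChain (iterCentralBond)
open Summit.QuantumFields.YangMills.Theorems.FluctuationComparisonRegPrIntLWregGlue (WindowChart)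
open Summit.QuantumFields.YangMills.Theorems.FluctuationComparisonRegPrIntLS2BetaResidualSubgroup
open Summit.QuantumFields.YangMills.Theorems.FluctuationComparisonRegPrIntLS2BetaTubularChartDockLocal
open Summit.QuantumFields.YangMills.Theorems.FluctuationComparisonRegPrIntLS2BetaTubularChartDockLocalWinId
open Literature.MathematicalPhysics.QuantumFieldTheory.Balaban1983to89.HaarExponentialChart
open Summit.QuantumFields.YangMills.Theorems.FluctuationComparisonRegPrIntLS2BetaTransversalShiftUniform
open Summit.QuantumFields.YangMills.Theorems.FluctuationComparisonRegPrIntLS2BetaSignedComb (combTransporter)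
open Summit.QuantumFields.YangMills.Theorems.FluctuationComparisonRegPrIntLS2BetaSignedCombKill (combSet)

namespace Summit.QuantumFields.YangMills.Theorems.FluctuationComparisonRegPrIntLS2BetaTubeOfRecordCover

variable (F : T3Family) {J K : ℕ} (hJK : J ≤ K)

/-! ## §0 The cover row survives the shrinking of the transversal window -/

/-- (F5) `UV = eV⁻¹' ball 0 (s_C∕2)` and `s_C < log 2 < 1` put every `y ∈ UV` in the shrunk window `‖(eV y)_b‖ < ½` (sup norm, component by component), so px21's docked
COVER row (F6) holds with `y ∈ UV ∩ {‖(eV y)_b‖ < ½}`. [cite: Helgason2000, Ch. I §1 Thm 1.14 (13) p.96 (bookkeeping)] -/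
theorem cover_shrunk_of_cover
    [DecidablePred (· ∈ (combSet (K - J) : Set (PBond (F.P K) 0)) ∪ Set.range (iterCentralBond (P := F.P K) (K - J)))]
    {dV : ℕ} {U₀ : GaugeField (F.P K) 0 (Matrix.specialUnitaryGroup (Fin 2) ℂ)}
    {σ : EuclideanSpace ℝ (Fin dV) → GaugeField (F.P K) 0 (Matrix.specialUnitaryGroup (Fin 2) ℂ)}
    {eV : EuclideanSpace ℝ (Fin dV) ≃L[ℝ] (piLogChart (specialUnitaryLogChart (Fin 2)) {b : PBond (F.P K) 0 // b ∉ (combSet (K - J) : Set (PBond (F.P K) 0)) ∪ Set.range (iterCentralBond (P := F.P K) (K - J))}).lie}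
    {UV : Set (EuclideanSpace ℝ (Fin dV))}
    (hF5 : UV = eV ⁻¹' Metric.ball (0 : (piLogChart (specialUnitaryLogChart (Fin 2)) {b : PBond (F.P K) 0 // b ∉ (combSet (K - J) : Set (PBond (F.P K) 0)) ∪ Set.range (iterCentralBond (P := F.P K) (K - J))}).lie)
      (IsChartRep.chartRadius (specialUnitaryLogChart (Fin 2)) / 2))
    (hF6 : ∀ V' : GaugeField (F.P K) 0 (Matrix.specialUnitaryGroup (Fin 2) ℂ),
        (∀ (b : PBond (F.P K) 0) (hb : b ∉ (combSet (K - J) : Set (PBond (F.P K) 0)) ∪ Set.range (iterCentralBond (P := F.P K) (K - J))),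
          (combTransporter (K - J) U₀ b.src * U₀ b * (combTransporter (K - J) U₀ b.tgt)⁻¹)⁻¹ *
              (combTransporter (K - J) V' b.src * V' b * (combTransporter (K - J) V' b.tgt)⁻¹) ∈
            (isChartRep_specialUnitaryGroup (n := Fin 2)).window (IsChartRep.chartRadius (specialUnitaryLogChart (Fin 2)) / 2)) →
        ∃ y ∈ UV, ∃ w : residualSubgroup F hJK,
          (w : Site (F.P K) 0 → Matrix.specialUnitaryGroup (Fin 2) ℂ) = (fun x => (combTransporter (K - J) V' x)⁻¹ * combTransporter (K - J) U₀ x) ∧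
          V' = pivotAct F hJK (iterCentralBond (P := F.P K) (K - J))
            (w, fun c => V' (iterCentralBond (P := F.P K) (K - J) c) * (U₀ (iterCentralBond (P := F.P K) (K - J) c))⁻¹) (σ y)) :
    ∀ V' : GaugeField (F.P K) 0 (Matrix.specialUnitaryGroup (Fin 2) ℂ),
      (∀ (b : PBond (F.P K) 0) (hb : b ∉ (combSet (K - J) : Set (PBond (F.P K) 0)) ∪ Set.range (iterCentralBond (P := F.P K) (K - J))),
        (combTransporter (K - J) U₀ b.src * U₀ b * (combTransporter (K - J) U₀ b.tgt)⁻¹)⁻¹ *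
            (combTransporter (K - J) V' b.src * V' b * (combTransporter (K - J) V' b.tgt)⁻¹) ∈
          (isChartRep_specialUnitaryGroup (n := Fin 2)).window (IsChartRep.chartRadius (specialUnitaryLogChart (Fin 2)) / 2)) →
      ∃ y ∈ UV ∩ {y : EuclideanSpace ℝ (Fin dV) | ∀ b : {b : PBond (F.P K) 0 // b ∉ (combSet (K - J) : Set (PBond (F.P K) 0)) ∪ Set.range (iterCentralBond (P := F.P K) (K - J))}, ‖((eV y : (piLogChart (specialUnitaryLogChart (Fin 2)) {b : PBond (F.P K) 0 // b ∉ (combSet (K - J) : Set (PBond (F.P K) 0)) ∪ Set.range (iterCentralBond (P := F.P K) (K - J))}).lie) : {b : PBond (F.P K) 0 // b ∉ (combSet (K - J) : Set (PBond (F.P K) 0)) ∪ Set.range (iterCentralBond (P := F.P K) (K - J))} → Matrix (Fin 2) (Fin 2) ℂ) b‖ < 1 / 2}, ∃ w : residualSubgroup F hJK,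
        (w : Site (F.P K) 0 → Matrix.specialUnitaryGroup (Fin 2) ℂ) = (fun x => (combTransporter (K - J) V' x)⁻¹ * combTransporter (K - J) U₀ x) ∧
        V' = pivotAct F hJK (iterCentralBond (P := F.P K) (K - J))
          (w, fun c => V' (iterCentralBond (P := F.P K) (K - J) c) * (U₀ (iterCentralBond (P := F.P K) (K - J) c))⁻¹) (σ y) := by
  have hhalf : IsChartRep.chartRadius (specialUnitaryLogChart (Fin 2)) / 2 < 1 / 2 := by
    have h1 := IsChartRep.chartRadius_lt_log_two (C := specialUnitaryLogChart (Fin 2))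
    have h2 := Real.log_two_lt_d9
    linarith
  intro V' hV'
  obtain ⟨y, hy, w, hw, hV⟩ := hF6 V' hV'
  refine ⟨y, ⟨hy, fun b => ?_⟩, w, hw, hV⟩
  have hyb : eV y ∈ Metric.ball (0 : (piLogChart (specialUnitaryLogChart (Fin 2)) {b : PBond (F.P K) 0 // b ∉ (combSet (K - J) : Set (PBond (F.P K) 0)) ∪ Set.range (iterCentralBond (P := F.P K) (K - J))}).lie)
      (IsChartRep.chartRadius (specialUnitaryLogChart (Fin 2)) / 2) := by
    have h := hy; rw [hF5] at h; exact h
  rw [mem_ball_zero_iff] at hyb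
  have hcomp : ‖((eV y : (piLogChart (specialUnitaryLogChart (Fin 2)) {b : PBond (F.P K) 0 // b ∉ (combSet (K - J) : Set (PBond (F.P K) 0)) ∪ Set.range (iterCentralBond (P := F.P K) (K - J))}).lie) : {b : PBond (F.P K) 0 // b ∉ (combSet (K - J) : Set (PBond (F.P K) 0)) ∪ Set.range (iterCentralBond (P := F.P K) (K - J))} → Matrix (Fin 2) (Fin 2) ℂ) b‖ ≤ ‖eV y‖ := by
    have h := norm_le_pi_norm (((eV y : (piLogChart (specialUnitaryLogChart (Fin 2)) {b : PBond (F.P K) 0 // b ∉ (combSet (K - J) : Set (PBond (F.P K) 0)) ∪ Set.range (iterCentralBond (P := F.P K) (K - J))}).lie) : {b : PBond (F.P K) 0 // b ∉ (combSet (K - J) : Set (PBond (F.P K) 0)) ∪ Set.range (iterCentralBond (P := F.P K) (K - J))} → Matrix (Fin 2) (Fin 2) ℂ)) b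
    exact h.trans_eq (Submodule.coe_norm _).symm
  linarith

/-! ## §1 The tube of record with its cover row -/

/-- ★★ **THE TUBE OF RECORD WITH ITS COVER ROW** — ✓`exists_tubeRows_framed` re-run over px21 g17's ✓`exists_tubularHaarChart_pivotAct_local_winId`, keeping every row and
adding (F6′): the docked COVER row with `y` in the SHRUNK transversal window of the tube of record.
[cite: Helgason2000, Ch. I §1 Thm 1.14 p.96; Balaban1985Variational, Thm 1 (8)-(10) p.279 and (19) p.281; Balaban1985RegularSpaces, Lemma 1 (1.25) p.79] -/
theorem exists_tubeRows_cover (hk : K - J ≤ (F.P K).m + (F.P K).K)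
    [DecidablePred (· ∈ (combSet (K - J) : Set (PBond (F.P K) 0)) ∪ Set.range (iterCentralBond (P := F.P K) (K - J)))] (dZ dV : ℕ)
    (hdZ : dZ = Module.finrank ℝ (specialUnitaryLogChart (Fin 2)).lie *
      ((Fintype.card (Site (F.P K) 0) - Fintype.card (Site (F.P K) (K - J))) + Fintype.card (PBond (F.P K) (K - J))))
    (hdV : dV = Module.finrank ℝ (specialUnitaryLogChart (Fin 2)).lie *
        (Fintype.card (PBond (F.P K) 0) - Fintype.card (PBond (F.P K) (K - J))) -
      Module.finrank ℝ (specialUnitaryLogChart (Fin 2)).lie * (Fintype.card (Site (F.P K) 0) - Fintype.card (Site (F.P K) (K - J))))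
    (U₀ : GaugeField (F.P K) 0 (Matrix.specialUnitaryGroup (Fin 2) ℂ)) :
    ∃ (e : EuclideanSpace ℝ (Fin dZ) → ↥(residualSubgroup F hJK) × (PBond (F.P K) (K - J) → Matrix.specialUnitaryGroup (Fin 2) ℂ))
      (σ : EuclideanSpace ℝ (Fin dV) → GaugeField (F.P K) 0 (Matrix.specialUnitaryGroup (Fin 2) ℂ))
      (eV : EuclideanSpace ℝ (Fin dV) ≃L[ℝ] (piLogChart (specialUnitaryLogChart (Fin 2)) {b : PBond (F.P K) 0 // b ∉ (combSet (K - J) : Set (PBond (F.P K) 0)) ∪ Set.range (iterCentralBond (P := F.P K) (K - J))}).lie)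
      (UZ : Set (EuclideanSpace ℝ (Fin dZ))) (UV : Set (EuclideanSpace ℝ (Fin dV)))
      (jZ : EuclideanSpace ℝ (Fin dZ) → ℝ) (jV : EuclideanSpace ℝ (Fin dV) → ℝ) (ρ : ℝ),
      σ 0 = U₀ ∧ (0 : EuclideanSpace ℝ (Fin dV)) ∈ UV ∧ 0 < jV 0 ∧ (∀ᶠ y in 𝓝 (0 : EuclideanSpace ℝ (Fin dV)), 0 < jV y) ∧
      (∀ y ∈ UV, ∀ b : {b : PBond (F.P K) 0 // b ∉ (combSet (K - J) : Set (PBond (F.P K) 0)) ∪ Set.range (iterCentralBond (P := F.P K) (K - J))}, ‖((eV y : (piLogChart (specialUnitaryLogChart (Fin 2)) {b : PBond (F.P K) 0 // b ∉ (combSet (K - J) : Set (PBond (F.P K) 0)) ∪ Set.range (iterCentralBond (P := F.P K) (K - J))}).lie) : {b : PBond (F.P K) 0 // b ∉ (combSet (K - J) : Set (PBond (F.P K) 0)) ∪ Set.range (iterCentralBond (P := F.P K) (K - J))} → Matrix (Fin 2) (Fin 2) ℂ) b‖ < 1 / 2) ∧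
      (∀ y ∈ UV, 0 < jV y) ∧
      (∀ y, ∀ b ∈ (combSet (K - J) : Set (PBond (F.P K) 0)) ∪ Set.range (iterCentralBond (P := F.P K) (K - J)), σ y b = U₀ b) ∧
      (∀ y, combTransporter (K - J) (σ y) = combTransporter (K - J) U₀) ∧
      (∀ y (b : PBond (F.P K) 0) (hb : b ∉ (combSet (K - J) : Set (PBond (F.P K) 0)) ∪ Set.range (iterCentralBond (P := F.P K) (K - J))),
        σ y b = U₀ b * ((combTransporter (K - J) U₀ b.tgt)⁻¹ *
          (isChartRep_specialUnitaryGroup (n := Fin 2)).expChart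
            (lieApply (specialUnitaryLogChart (Fin 2)) {b : PBond (F.P K) 0 // b ∉ (combSet (K - J) : Set (PBond (F.P K) 0)) ∪ Set.range (iterCentralBond (P := F.P K) (K - J))} (eV y) ⟨b, hb⟩) *
          combTransporter (K - J) U₀ b.tgt)) ∧
      (∃ σ₀ : ℝ, 0 < σ₀ ∧ ∀ y, jV y = σ₀ * |LinearMap.det
        (jac (lie_adStable_pi (specialUnitaryLogChart (Fin 2)) {b : PBond (F.P K) 0 // b ∉ (combSet (K - J) : Set (PBond (F.P K) 0)) ∪ Set.range (iterCentralBond (P := F.P K) (K - J))}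
            (lie_adStable_specialUnitaryGroup (n := Fin 2))) (eV y) :
          (piLogChart (specialUnitaryLogChart (Fin 2)) {b : PBond (F.P K) 0 // b ∉ (combSet (K - J) : Set (PBond (F.P K) 0)) ∪ Set.range (iterCentralBond (P := F.P K) (K - J))}).lie →ₗ[ℝ]
          (piLogChart (specialUnitaryLogChart (Fin 2)) {b : PBond (F.P K) 0 // b ∉ (combSet (K - J) : Set (PBond (F.P K) 0)) ∪ Set.range (iterCentralBond (P := F.P K) (K - J))}).lie)|) ∧
      (∀ V' : GaugeField (F.P K) 0 (Matrix.specialUnitaryGroup (Fin 2) ℂ),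
        (∀ (b : PBond (F.P K) 0) (hb : b ∉ (combSet (K - J) : Set (PBond (F.P K) 0)) ∪ Set.range (iterCentralBond (P := F.P K) (K - J))),
          (combTransporter (K - J) U₀ b.src * U₀ b * (combTransporter (K - J) U₀ b.tgt)⁻¹)⁻¹ *
              (combTransporter (K - J) V' b.src * V' b * (combTransporter (K - J) V' b.tgt)⁻¹) ∈
            (isChartRep_specialUnitaryGroup (n := Fin 2)).window (IsChartRep.chartRadius (specialUnitaryLogChart (Fin 2)) / 2)) →
        ∃ y ∈ UV, ∃ w : residualSubgroup F hJK,
          (w : Site (F.P K) 0 → Matrix.specialUnitaryGroup (Fin 2) ℂ) = (fun x => (combTransporter (K - J) V' x)⁻¹ * combTransporter (K - J) U₀ x) ∧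
          V' = pivotAct F hJK (iterCentralBond (P := F.P K) (K - J))
            (w, fun c => V' (iterCentralBond (P := F.P K) (K - J) c) * (U₀ (iterCentralBond (P := F.P K) (K - J) c))⁻¹) (σ y)) ∧
      (Continuous e ∧ e 0 = 1 ∧
      𝓝 (1 : ↥(residualSubgroup F hJK) × (PBond (F.P K) (K - J) → Matrix.specialUnitaryGroup (Fin 2) ℂ)) ≤ map e (𝓝 0) ∧
      Continuous σ ∧
      ContDiff ℝ ⊤ (fun y : EuclideanSpace ℝ (Fin dV) => fun b : PBond (F.P K) 0 => ((σ y b : Matrix.specialUnitaryGroup (Fin 2) ℂ) : Matrix (Fin 2) (Fin 2) ℂ)) ∧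
      IsOpen UZ ∧ IsOpen UV ∧ (0 : EuclideanSpace ℝ (Fin dZ)) ∈ UZ ∧
      (∀ y₁ ∈ UV, ∃ c : ℝ, 0 < c ∧ ∀ᶠ v in 𝓝 (0 : EuclideanSpace ℝ (Fin dV)),
        c * ‖v‖ ^ 2 ≤ ⨅ w : {w : Site (F.P K) 0 → Matrix.specialUnitaryGroup (Fin 2) ℂ |
              ∀ U : GaugeField (F.P K) 0 (Matrix.specialUnitaryGroup (Fin 2) ℂ),
                descendTo F ℰp J K hJK (GaugeField.gaugeAct w U) = descendTo F ℰp J K hJK U},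
            ∑ ℓ ∈ Finset.univ.filter (fun ℓ : PBond (F.P K) 0 =>
                ∀ c', iterCentralBond (P := F.P K) (K - J) c' ≠ ℓ),
              dist1 (σ (y₁ + v) ℓ * ((GaugeField.gaugeAct (w : Site (F.P K) 0 → Matrix.specialUnitaryGroup (Fin 2) ℂ) (σ y₁)) ℓ)⁻¹) ^ 2) ∧
      InjOn (fun p : EuclideanSpace ℝ (Fin dZ) × EuclideanSpace ℝ (Fin dV) =>
        pivotAct F hJK (iterCentralBond (P := F.P K) (K - J)) (e p.1) (σ p.2)) (UZ ×ˢ UV) ∧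
      (∀ p ∈ UZ ×ˢ UV, ∀ s ∈ 𝓝 p, (fun p : EuclideanSpace ℝ (Fin dZ) × EuclideanSpace ℝ (Fin dV) =>
        pivotAct F hJK (iterCentralBond (P := F.P K) (K - J)) (e p.1) (σ p.2)) '' s ∈
        𝓝 ((fun p : EuclideanSpace ℝ (Fin dZ) × EuclideanSpace ℝ (Fin dV) =>
        pivotAct F hJK (iterCentralBond (P := F.P K) (K - J)) (e p.1) (σ p.2)) p)) ∧
      ContinuousOn jZ UZ ∧ ContinuousOn jV UV ∧ (∀ z ∈ UZ, 0 ≤ jZ z) ∧ (∀ y ∈ UV, 0 ≤ jV y) ∧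
      (fieldMeasure (F.P K) 0 (Matrix.specialUnitaryGroup (Fin 2) ℂ)).restrict
          ((fun p : EuclideanSpace ℝ (Fin dZ) × EuclideanSpace ℝ (Fin dV) =>
            pivotAct F hJK (iterCentralBond (P := F.P K) (K - J)) (e p.1) (σ p.2)) '' (UZ ×ˢ UV)) =
        ((((volume : Measure (EuclideanSpace ℝ (Fin dZ))).prod (volume : Measure (EuclideanSpace ℝ (Fin dV)))).restrict (UZ ×ˢ UV)).withDensity
            fun w => ENNReal.ofReal (jZ w.1 * jV w.2)).map
          (fun p : EuclideanSpace ℝ (Fin dZ) × EuclideanSpace ℝ (Fin dV) =>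
            pivotAct F hJK (iterCentralBond (P := F.P K) (K - J)) (e p.1) (σ p.2)) ∧
      0 < ρ ∧ Metric.closedBall (0 : EuclideanSpace ℝ (Fin dZ)) ρ ⊆ UZ ∧ 0 < ∫ z in Metric.ball (0 : EuclideanSpace ℝ (Fin dZ)) ρ, jZ z) := by
  obtain ⟨e, σ, eV, UZ, UV, jZ, jV, ρ, he, he1, he𝓝, hσ, hσ0, hσs, hD0, hD1, hF4a, -, -, hUZo, hUVo, h0Z, h0V, hinj, hF3,
      hjZc, hjVc, hjZ0, hjV0, -, hjVpos, hjVev, hF4b, hchart, hρ, hρUZ, hjZint, hF5, hF6⟩ :=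
    exists_tubularHaarChart_pivotAct_local_winId F hJK hk dZ dV hdZ hdV U₀
  -- the uniform off-pivot transversality of the tube on the small window
  obtain ⟨c₁, hc₁, hT2u⟩ := offPivot_transversal_shift_uniform F hJK hk eV hD0 hD1 hF4a
  -- the shrunk transversal window `UV ∩ S`, `S := ‖(eV y)_b‖ < 1/2` for every free bond
  have hSo : IsOpen {y : EuclideanSpace ℝ (Fin dV) | ∀ b : {b : PBond (F.P K) 0 // b ∉ (combSet (K - J) : Set (PBond (F.P K) 0)) ∪ Set.range (iterCentralBond (P := F.P K) (K - J))}, ‖((eV y : (piLogChart (specialUnitaryLogChart (Fin 2)) {b : PBond (F.P K) 0 // b ∉ (combSet (K - J) : Set (PBond (F.P K) 0)) ∪ Set.range (iterCentralBond (P := F.P K) (K - J))}).lie) : {b : PBond (F.P K) 0 // b ∉ (combSet (K - J) : Set (PBond (F.P K) 0)) ∪ Set.range (iterCentralBond (P := F.P K) (K - J))} → Matrix (Fin 2) (Fin 2) ℂ) b‖ < 1 / 2} := by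
    rw [Set.setOf_forall]
    refine isOpen_iInter_of_finite fun b => ?_
    have hcont : Continuous fun y : EuclideanSpace ℝ (Fin dV) =>
        ‖((eV y : (piLogChart (specialUnitaryLogChart (Fin 2)) {b : PBond (F.P K) 0 // b ∉ (combSet (K - J) : Set (PBond (F.P K) 0)) ∪ Set.range (iterCentralBond (P := F.P K) (K - J))}).lie) : {b : PBond (F.P K) 0 // b ∉ (combSet (K - J) : Set (PBond (F.P K) 0)) ∪ Set.range (iterCentralBond (P := F.P K) (K - J))} → Matrix (Fin 2) (Fin 2) ℂ) b‖ :=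
      ((continuous_apply b).comp (continuous_subtype_val.comp eV.continuous)).norm
    exact isOpen_lt hcont continuous_const
  have h0S : (0 : EuclideanSpace ℝ (Fin dV)) ∈ {y : EuclideanSpace ℝ (Fin dV) | ∀ b : {b : PBond (F.P K) 0 // b ∉ (combSet (K - J) : Set (PBond (F.P K) 0)) ∪ Set.range (iterCentralBond (P := F.P K) (K - J))}, ‖((eV y : (piLogChart (specialUnitaryLogChart (Fin 2)) {b : PBond (F.P K) 0 // b ∉ (combSet (K - J) : Set (PBond (F.P K) 0)) ∪ Set.range (iterCentralBond (P := F.P K) (K - J))}).lie) : {b : PBond (F.P K) 0 // b ∉ (combSet (K - J) : Set (PBond (F.P K) 0)) ∪ Set.range (iterCentralBond (P := F.P K) (K - J))} → Matrix (Fin 2) (Fin 2) ℂ) b‖ < 1 / 2} := by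
    intro b
    simp only [map_zero, ZeroMemClass.coe_zero, Pi.zero_apply, norm_zero]
    norm_num
  have hUV'o : IsOpen (UV ∩ {y : EuclideanSpace ℝ (Fin dV) | ∀ b : {b : PBond (F.P K) 0 // b ∉ (combSet (K - J) : Set (PBond (F.P K) 0)) ∪ Set.range (iterCentralBond (P := F.P K) (K - J))}, ‖((eV y : (piLogChart (specialUnitaryLogChart (Fin 2)) {b : PBond (F.P K) 0 // b ∉ (combSet (K - J) : Set (PBond (F.P K) 0)) ∪ Set.range (iterCentralBond (P := F.P K) (K - J))}).lie) : {b : PBond (F.P K) 0 // b ∉ (combSet (K - J) : Set (PBond (F.P K) 0)) ∪ Set.range (iterCentralBond (P := F.P K) (K - J))} → Matrix (Fin 2) (Fin 2) ℂ) b‖ < 1 / 2}) := hUVo.inter hSo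
  have hsub : UZ ×ˢ (UV ∩ {y : EuclideanSpace ℝ (Fin dV) | ∀ b : {b : PBond (F.P K) 0 // b ∉ (combSet (K - J) : Set (PBond (F.P K) 0)) ∪ Set.range (iterCentralBond (P := F.P K) (K - J))}, ‖((eV y : (piLogChart (specialUnitaryLogChart (Fin 2)) {b : PBond (F.P K) 0 // b ∉ (combSet (K - J) : Set (PBond (F.P K) 0)) ∪ Set.range (iterCentralBond (P := F.P K) (K - J))}).lie) : {b : PBond (F.P K) 0 // b ∉ (combSet (K - J) : Set (PBond (F.P K) 0)) ∪ Set.range (iterCentralBond (P := F.P K) (K - J))} → Matrix (Fin 2) (Fin 2) ℂ) b‖ < 1 / 2}) ⊆ UZ ×ˢ UV := prod_mono le_rfl inter_subset_left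
  -- the tube map is continuous, hence measurable
  have hΘc : Continuous (fun p : EuclideanSpace ℝ (Fin dZ) × EuclideanSpace ℝ (Fin dV) => pivotAct F hJK (iterCentralBond (P := F.P K) (K - J)) (e p.1) (σ p.2)) :=
    (continuous_pivotAct F hJK (iterCentralBond (P := F.P K) (K - J))).comp₂ (he.comp continuous_fst) (hσ.comp continuous_snd)
  have hΘm : Measurable (fun p : EuclideanSpace ℝ (Fin dZ) × EuclideanSpace ℝ (Fin dV) => pivotAct F hJK (iterCentralBond (P := F.P K) (K - J)) (e p.1) (σ p.2)) := hΘc.measurable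
  -- the image of the smaller window is open ((F3)), hence measurable
  have hAopen : IsOpen ((fun p : EuclideanSpace ℝ (Fin dZ) × EuclideanSpace ℝ (Fin dV) => pivotAct F hJK (iterCentralBond (P := F.P K) (K - J)) (e p.1) (σ p.2)) '' (UZ ×ˢ (UV ∩ {y : EuclideanSpace ℝ (Fin dV) | ∀ b : {b : PBond (F.P K) 0 // b ∉ (combSet (K - J) : Set (PBond (F.P K) 0)) ∪ Set.range (iterCentralBond (P := F.P K) (K - J))}, ‖((eV y : (piLogChart (specialUnitaryLogChart (Fin 2)) {b : PBond (F.P K) 0 // b ∉ (combSet (K - J) : Set (PBond (F.P K) 0)) ∪ Set.range (iterCentralBond (P := F.P K) (K - J))}).lie) : {b : PBond (F.P K) 0 // b ∉ (combSet (K - J) : Set (PBond (F.P K) 0)) ∪ Set.range (iterCentralBond (P := F.P K) (K - J))} → Matrix (Fin 2) (Fin 2) ℂ) b‖ < 1 / 2}))) := by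
    refine isOpen_iff_mem_nhds.2 ?_
    rintro _ ⟨p, hp, rfl⟩
    exact hF3 p (hsub hp) _ ((hUZo.prod hUV'o).mem_nhds hp)
  have hA : MeasurableSet ((fun p : EuclideanSpace ℝ (Fin dZ) × EuclideanSpace ℝ (Fin dV) => pivotAct F hJK (iterCentralBond (P := F.P K) (K - J)) (e p.1) (σ p.2)) '' (UZ ×ˢ (UV ∩ {y : EuclideanSpace ℝ (Fin dV) | ∀ b : {b : PBond (F.P K) 0 // b ∉ (combSet (K - J) : Set (PBond (F.P K) 0)) ∪ Set.range (iterCentralBond (P := F.P K) (K - J))}, ‖((eV y : (piLogChart (specialUnitaryLogChart (Fin 2)) {b : PBond (F.P K) 0 // b ∉ (combSet (K - J) : Set (PBond (F.P K) 0)) ∪ Set.range (iterCentralBond (P := F.P K) (K - J))}).lie) : {b : PBond (F.P K) 0 // b ∉ (combSet (K - J) : Set (PBond (F.P K) 0)) ∪ Set.range (iterCentralBond (P := F.P K) (K - J))} → Matrix (Fin 2) (Fin 2) ℂ) b‖ < 1 / 2}))) := hAopen.measurableSet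
  -- the Haar chart identity restricted to the smaller window
  have hchart' : (fieldMeasure (F.P K) 0 (Matrix.specialUnitaryGroup (Fin 2) ℂ)).restrict ((fun p : EuclideanSpace ℝ (Fin dZ) × EuclideanSpace ℝ (Fin dV) => pivotAct F hJK (iterCentralBond (P := F.P K) (K - J)) (e p.1) (σ p.2)) '' (UZ ×ˢ (UV ∩ {y : EuclideanSpace ℝ (Fin dV) | ∀ b : {b : PBond (F.P K) 0 // b ∉ (combSet (K - J) : Set (PBond (F.P K) 0)) ∪ Set.range (iterCentralBond (P := F.P K) (K - J))}, ‖((eV y : (piLogChart (specialUnitaryLogChart (Fin 2)) {b : PBond (F.P K) 0 // b ∉ (combSet (K - J) : Set (PBond (F.P K) 0)) ∪ Set.range (iterCentralBond (P := F.P K) (K - J))}).lie) : {b : PBond (F.P K) 0 // b ∉ (combSet (K - J) : Set (PBond (F.P K) 0)) ∪ Set.range (iterCentralBond (P := F.P K) (K - J))} → Matrix (Fin 2) (Fin 2) ℂ) b‖ < 1 / 2}))) =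
      ((((volume : Measure (EuclideanSpace ℝ (Fin dZ))).prod (volume : Measure (EuclideanSpace ℝ (Fin dV)))).restrict (UZ ×ˢ (UV ∩ {y : EuclideanSpace ℝ (Fin dV) | ∀ b : {b : PBond (F.P K) 0 // b ∉ (combSet (K - J) : Set (PBond (F.P K) 0)) ∪ Set.range (iterCentralBond (P := F.P K) (K - J))}, ‖((eV y : (piLogChart (specialUnitaryLogChart (Fin 2)) {b : PBond (F.P K) 0 // b ∉ (combSet (K - J) : Set (PBond (F.P K) 0)) ∪ Set.range (iterCentralBond (P := F.P K) (K - J))}).lie) : {b : PBond (F.P K) 0 // b ∉ (combSet (K - J) : Set (PBond (F.P K) 0)) ∪ Set.range (iterCentralBond (P := F.P K) (K - J))} → Matrix (Fin 2) (Fin 2) ℂ) b‖ < 1 / 2}))).withDensity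
          fun w => ENNReal.ofReal (jZ w.1 * jV w.2)).map (fun p : EuclideanSpace ℝ (Fin dZ) × EuclideanSpace ℝ (Fin dV) => pivotAct F hJK (iterCentralBond (P := F.P K) (K - J)) (e p.1) (σ p.2)) := by
    have h1 : (fieldMeasure (F.P K) 0 (Matrix.specialUnitaryGroup (Fin 2) ℂ)).restrict ((fun p : EuclideanSpace ℝ (Fin dZ) × EuclideanSpace ℝ (Fin dV) => pivotAct F hJK (iterCentralBond (P := F.P K) (K - J)) (e p.1) (σ p.2)) '' (UZ ×ˢ (UV ∩ {y : EuclideanSpace ℝ (Fin dV) | ∀ b : {b : PBond (F.P K) 0 // b ∉ (combSet (K - J) : Set (PBond (F.P K) 0)) ∪ Set.range (iterCentralBond (P := F.P K) (K - J))}, ‖((eV y : (piLogChart (specialUnitaryLogChart (Fin 2)) {b : PBond (F.P K) 0 // b ∉ (combSet (K - J) : Set (PBond (F.P K) 0)) ∪ Set.range (iterCentralBond (P := F.P K) (K - J))}).lie) : {b : PBond (F.P K) 0 // b ∉ (combSet (K - J) : Set (PBond (F.P K) 0)) ∪ Set.range (iterCentralBond (P := F.P K) (K - J))} → Matrix (Fin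 2) (Fin 2) ℂ) b‖ < 1 / 2}))) =
        ((fieldMeasure (F.P K) 0 (Matrix.specialUnitaryGroup (Fin 2) ℂ)).restrict ((fun p : EuclideanSpace ℝ (Fin dZ) × EuclideanSpace ℝ (Fin dV) => pivotAct F hJK (iterCentralBond (P := F.P K) (K - J)) (e p.1) (σ p.2)) '' (UZ ×ˢ UV))).restrict ((fun p : EuclideanSpace ℝ (Fin dZ) × EuclideanSpace ℝ (Fin dV) => pivotAct F hJK (iterCentralBond (P := F.P K) (K - J)) (e p.1) (σ p.2)) '' (UZ ×ˢ (UV ∩ {y : EuclideanSpace ℝ (Fin dV) | ∀ b : {b : PBond (F.P K) 0 // b ∉ (combSet (K - J) : Set (PBond (F.P K) 0)) ∪ Set.range (iterCentralBond (P := F.P K) (K - J))}, ‖((eV y : (piLogChart (specialUnitaryLogChart (Fin 2)) {b : PBond (F.P K) 0 // b ∉ (combSet (K - J) : Set (PBond (F.P K) 0)) ∪ Set.range (iterCentralBond (P := F.P K) (K - J))}).lie) : {b : PBond (F.P K) 0 // b ∉ (combSet (K - J) : Set (PBond (F.P K) 0)) ∪ Set.range (iterCentralBond (P := F.P K) (K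 - J))} → Matrix (Fin 2) (Fin 2) ℂ) b‖ < 1 / 2}))) := by
      rw [Measure.restrict_restrict hA, inter_eq_left.2 (image_mono hsub)]
    rw [h1, hchart, Measure.restrict_map hΘm hA, restrict_withDensity (hA.preimage hΘm), Measure.restrict_restrict (hA.preimage hΘm),
      hinj.preimage_image_inter hsub]
  -- positivity of the transversal density on the WHOLE shrunk window: `jV = σ₀·|det jac(eV ·)|` ((F4b′)) and the product-algebra
  -- Jacobian has positive determinant once every free coordinate is shorter than `π` (✓`det_jac_pi_su2_pos`)
  have hjVall : ∀ y ∈ UV ∩ {y : EuclideanSpace ℝ (Fin dV) | ∀ b : {b : PBond (F.P K) 0 // b ∉ (combSet (K - J) : Set (PBond (F.P K) 0)) ∪ Set.range (iterCentralBond (P := F.P K) (K - J))}, ‖((eV y : (piLogChart (specialUnitaryLogChart (Fin 2)) {b : PBond (F.P K) 0 // b ∉ (combSet (K - J) : Set (PBond (F.P K) 0)) ∪ Set.range (iterCentralBond (P := F.P K) (K - J))}).lie) : {b : PBond (F.P K) 0 // b ∉ (combSet (K - J) : Set (PBond (F.P K) 0)) ∪ Set.range (iterCentralBond (P := F.P K)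 (K - J))} → Matrix (Fin 2) (Fin 2) ℂ) b‖ < 1 / 2}, 0 < jV y := by
    obtain ⟨σ₀, hσ₀, hjVeq⟩ := hF4b
    intro y hy
    rw [hjVeq y]
    refine mul_pos hσ₀ (abs_pos.2 (ne_of_gt ?_))
    refine FluctuationComparisonRegPrIntLS2BetaJacPiSinc.det_jac_pi_su2_pos _ (eV y) fun b => ?_
    have hb := hy.2 b
    have hπ : (1 : ℝ) / 2 < Real.pi := by linarith [Real.pi_gt_three]
    exact hb.trans hπ
  -- (F6′): px21's docked cover with `y` in the SHRUNK window (§0)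
  have hF6' := cover_shrunk_of_cover F hJK (σ := σ) hF5 hF6
  refine ⟨e, σ, eV, UZ, UV ∩ {y : EuclideanSpace ℝ (Fin dV) | ∀ b : {b : PBond (F.P K) 0 // b ∉ (combSet (K - J) : Set (PBond (F.P K) 0)) ∪ Set.range (iterCentralBond (P := F.P K) (K - J))}, ‖((eV y : (piLogChart (specialUnitaryLogChart (Fin 2)) {b : PBond (F.P K) 0 // b ∉ (combSet (K - J) : Set (PBond (F.P K) 0)) ∪ Set.range (iterCentralBond (P := F.P K) (K - J))}).lie) : {b : PBond (F.P K) 0 // b ∉ (combSet (K - J) : Set (PBond (F.P K) 0)) ∪ Set.range (iterCentralBond (P := F.P K) (K - J))} → Matrix (Fin 2) (Fin 2) ℂ) b‖ < 1 / 2}, jZ, jV, ρ, hσ0, ⟨h0V, h0S⟩, hjVpos, hjVev,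
    fun y hy b => hy.2 b, hjVall, hD0, hD1, hF4a, hF4b, hF6', he, he1, he𝓝, hσ, hσs, hUZo, hUV'o, h0Z, ?_, hinj.mono hsub,
    fun p hp s hs => hF3 p (hsub hp) s hs, hjZc.continuousOn, hjVc.continuousOn, fun z _ => hjZ0 z, fun y _ => hjV0 y, hchart', hρ, hρUZ, hjZint⟩
  -- (T2-ALL) on the small window
  intro y₁ hy₁
  exact ⟨c₁, hc₁, hT2u y₁ fun b => (hy₁.2 b).le⟩

end Summit.QuantumFields.YangMills.Theorems.FluctuationComparisonRegPrIntLS2BetaTubeOfRecordCover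

end
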